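import Literature.AlgebraicGeometry.HodgeTheory.HodgeLociOfGriffiths
import Summits.HodgeConjecture.HodgeConjecture.Theorems.Ring2AbelianAllAndreFibreProductPencils
import HarnessLib

/-!
# Route MarkmanPartnerTransport · crux `PicardThreeK3Squares` (stmt-HodgeConjecture-19652) — the analytic
# half of the RM locus: on the base of a smooth projective family of SURFACES the locus where a flat class
# of `H⁴` of the FIBRE SQUARES stays in `F²` is CLOSED (Voisin II Lemma 5.13 ∕ Griffiths 1968)

Cell hodge-nonav, planner p1 g36 (PICK 2, NEXT-1, 2026-08-28T09:43:06Z), prover seat 20241-p1 (g12). SUPPORT FILE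
(`--supports stmt-HodgeConjecture-19652`, helper): CONDITIONAL on the general named fact
`Griffiths1968_holomorphicHodgeSubbundles` (Voisin I Thm. 10.3); credits nothing; nothing here says HC is proved.

The line «RM-type descent» (`RMTypeDefs`, `RMTypeDescent`, memo ROUTE-P1AI §A) displays, per rational
real-multiplication type `θ`, the moduli input `RMTypeDominated θ`; its intended discharge runs over the
RM component `D_θ = {b : θ_b ∈ F²H⁴(S_b × S_b)}` of the base of a family of marked K3 surfaces, where `θ_b` is
the flat transport of a class of `H² ⊗ H² ⊂ H⁴(S × S)`. The ANALYTIC half of «`D_θ` is an algebraic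
subvariety» is that `D_θ` is CLOSED (Voisin II Lemma 5.13); the algebraic half is Cattani–Deligne–Kaplan (a
fact-level input, not here). This file records the analytic half as an instance of the tree's general theorem
`isInHodgeFiltration_fiberRestrict_of_mem_closure_of_griffiths1968` (`Literature/…/HodgeLociOfGriffiths`, Lemma
5.13 for every smooth projective family over a smooth quasi-projective base, from Griffiths' theorem) applied
to the FIBRE-SQUARE family `𝒮 ×_B 𝒮 ⟶ B` (`familyPullback.snd π π ≫ π`), a smooth projective family of relative
dimension `2 + 2` by `Ring2.AbelianAll.isSmoothProjectiveFamily_familyPullback_snd_comp` (fibres `S_b × S_b`).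

* `isInHodgeFiltration_fiberRestrict_fibreSquare_of_mem_closure_of_griffiths1968` — for `π : 𝒮 → B` a smooth
  projective family of surfaces over a smooth quasi-projective `B` of dimension `d`, an open `W ⊆ B(ℂ)`, a tube
  class `ξ ∈ H⁴` of the fibre-square family over `W`, a level `r` and `b ∈ W` in the closure of
  `{b' ∈ W | ξ|_{S_{b'} × S_{b'}} ∈ Fʳ}`: `ξ|_{S_b × S_b} ∈ Fʳ`.

NOTE: the only Summits import is `Ring2AbelianAllAndreFibreProductPencils`, for the folklore family lemma
`isSmoothProjectiveFamily_familyPullback_snd_comp` (fibres of `𝒴 ×_S 𝒳 → S` are `𝒴_s × 𝒳_s`).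

References: C. Voisin, *Hodge Theory II* (2003), §5.3.1 Lemma 5.13; *Hodge Theory I* (2002), §10.2.1 Thm. 10.3;
E. Cattani, P. Deligne, A. Kaplan, JAMS 8 (1995), Cor. 1.2; B. van Geemen, M. Schütt, Forum Math. Sigma 13
(2025) e2, §3.4.
-/

set_option linter.dupNamespace false

noncomputable section

open _root_.Topology _root_.Filter

namespace Summit.HodgeConjecture.HodgeConjecture.Theorems.MarkmanPartnerTransport.RMLocusClosed

open CategoryTheory
open Literature.AlgebraicTopology.SingularHomology Literature.AlgebraicGeometry.Motives
open Literature.AlgebraicGeometry.HodgeTheory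
open Summit.HodgeConjecture.HodgeConjecture.Ring2.AbelianAll

/-- **The locus `{b : ξ|_{S_b × S_b} ∈ Fʳ}` of a flat class of `H⁴` of the fibre squares of a smooth projective
family of surfaces is CLOSED** (Voisin II Lemma 5.13 for the fibre-square family `𝒮 ×_B 𝒮 → B`, granted
Griffiths' theorem): for `π : 𝒮 → B` a smooth projective family of relative dimension `2` over a smooth
quasi-projective `ℂ`-scheme `B` of dimension `d`, an open `W ⊆ B(ℂ)`, a tube class `ξ` of degree `4` of the
family `familyPullback.snd π π ≫ π` over `W`, and `b ∈ W` in the closure of `{b' ∈ W | ξ|_{b'} ∈ Fʳ}`: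
`ξ|_b ∈ Fʳ` — the analytic half of «the RM locus `D_θ` is algebraic» for (I1′) `RMComponentFamily`.
[cite: VoisinHodgeII2003, §5.3.1 Lemma 5.13] [cite: VoisinHodgeI2002, §10.2.1 Thm. 10.3] -/
theorem isInHodgeFiltration_fiberRestrict_fibreSquare_of_mem_closure_of_griffiths1968
    (hG : Griffiths1968_holomorphicHodgeSubbundles)
    {𝒮 B : SchemeOver ℂ} (π : 𝒮 ⟶ B) (d : ℕ) (hπ : IsSmoothProjectiveFamily π 2)
    (hB : IsQuasiProjectiveOver B) [AlgebraicGeometry.SmoothOfRelativeDimension d B.hom]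
    {W : Set (ComplexPoints B)} (hWo : IsOpen W)
    (ξ : singularCohomology ℂ ℂ (tubeOver (familyPullback.snd π π ≫ π) W) (2 * 2)) (r : ℕ)
    {b : ComplexPoints B} (hbW : b ∈ W)
    (hcl : b ∈ closure {b' | ∃ hb' : b' ∈ W,
      IsInHodgeFiltration (2 + 2) (fiberOver (familyPullback.snd π π ≫ π) b') (2 * 2) r
        (fiberRestrict (familyPullback.snd π π ≫ π) hb' (2 * 2) ξ)}) :
    IsInHodgeFiltration (2 + 2) (fiberOver (familyPullback.snd π π ≫ π) b) (2 * 2) r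
      (fiberRestrict (familyPullback.snd π π ≫ π) hbW (2 * 2) ξ) :=
  isInHodgeFiltration_fiberRestrict_of_mem_closure_of_griffiths1968 hG (familyPullback.snd π π ≫ π) (2 + 2) (2 * 2) d
    (isSmoothProjectiveFamily_familyPullback_snd_comp hπ hπ) hB hWo ξ r hbW hcl

end Summit.HodgeConjecture.HodgeConjecture.Theorems.MarkmanPartnerTransport.RMLocusClosed

end
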